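import Summits.QuantumFields.BalabanUV.Beta.SecondOrderTableLawEnd
import Summits.QuantumFields.BalabanUV.Beta.WardLocusParityLevels
import Summits.QuantumFields.BalabanUV.Beta.SecondOrderLockPin
import Literature.MathematicalPhysics.QuantumFieldTheory.Balaban1983to89.Beta.StepDriftWitness

/-!
# `BalabanUV.Beta.RowD1JointEnd` — binder row D1: **THE LITERAL OF RECORD `JsRowD1` AND THE ROW's END AS ONE KERNEL STATEMENT** —
# hW ∧ hR for ONE `Js` from the displayed letters of BOTH sides, and `D1Drift` for that `Js` from EXACTLY {letters, D1Tel, D1Rep, printed B5 facts, window}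
# (β sub-cell, row BETA-an2 = BINDER-OWNERS row D1 OWNER, lineage an2 gen 21, K-Q)

HONEST FRAMING (cell charter, verbatim): «discharging BetaPertH makes Balaban's UV stability UNCONDITIONAL — a real
constructive-QFT result; it is NOT the continuum limit and NOT the Clay problem.»
HONEST DEPENDENCY: continuum YM on T⁴ ⇐ BetaPertH ∧ nine spine estimates (0/9 proved); BetaPertH ⇐ (D1) ∧ (D4) ∧ CAP+tail;
G-an2-4 gates asym, D1 and NE2/3/4.
DERIVED cell leaf ([folklore] wiring BY NAME; [our object] one definition = a NAME for an existing literal).  No statement of Bałaban's papers, no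
`[cite:]`, no `Prop` fact is minted; EVERY letter below is a displayed HYPOTHESIS (an1's table identities — targets of the AVG-LETTERS chain, an3∕leaf-05 —
and the hW-side Ward letters of leaf-06's `WardLocusParityLevels.…_TW_su_exact₀`), and so are `D1Tel`, `D1Rep`, the printed B5 facts `h12`∕`h126` and the
window data of `OneStepKernelFamily.d1Drift_of_D1Tel_D1Rep`.  Discharges NO binder of the wall: 0∕4 (hW, hR, D1Tel, D1Rep) for the literal of record.
NOT D1, NOT `BetaPertH`, NOT continuum, NOT Clay.

WHY THIS FILE (owner decision X-an2-51, gen 21).  The route theorem `OneStepKernelFamily.d1Drift_of_D1Tel_D1Rep` asks hW AND hR of ONE step-jet family `Js`.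
The fully modelled hR literal (K-M2 p222778, tables `vh₂SModel`∕`Mmodel`) is hR-ONLY: leaf-06's kernel NO-GO `WardMixedModelNoGo.not_wardMixed_Mmodel`
(p223905) shows `Mmodel` violates the hW mixed Ward letter.  The literal of record for the row is therefore the one over an1's TRUE averaging tables:
border `vh₂SAn1 Lc` (K-N: anti-twin packing of the (g,h)-symmetrised `vh₂SAt ρ_c Lc`), mixed `mixFFAt ρ_c Lc`, Wilson `T_W := (8N²)⁻¹ • wsym22 N`, pins
`(cE, cVH, cE₂) = (Lc⁴, −Lc⁸∕2, Lc⁸)`, centred root, odd `Lc` — NAMED here `JsRowD1 hLc N cΛ cB`.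

WHAT (`d + 1 = 4`):
* §1 [our object] **`JsRowD1 hLc N cΛ cB : ℕ → JetData 3 Lc`** := `SpineRooted.JsRecWAtOf hLc.pos (ctrOff_mem_box hLc.pos) Lc⁴ (−Lc⁸∕2) cΛ Lc⁸ cB T_W
  (SecondOrderTableLawEnd.locStencil₂_vh₂SAn1 hLc) (MixedJetTablesPlug.hmix_an1 …)` (`rfl`-unfolding `JsRowD1_eq`).
* §2 **`wardTransversal_flipK_TbalOf_JsRowD1_of_wardLetters`**: hW for `JsRowD1` ⟸ leaf-06's three level-0 Ward letters AT THESE TABLES — (W-B₀) `hBord0`,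
  (W-B₀″) `hBord0''` for `vh₂SAn1 Lc`, (W-M₀) `hM₂0` for `mixFFAt ρ_c Lc` with ONE residual table `RW₀` (`VertexFamily` class, row-parity-odd) —
  `WardLocusParityLevels.…_TW_su_exact₀` at `r := ctrOff 4 Lc`, `cE₂ := Lc⁸`, with `hB`∕`hBt`∕`hmix`∕`hmixt` DISCHARGED (K-P `locStencil₂_vh₂SAn1`∕`vh₂SAn1_translate`,
  `hmix_an1`∕`hmixt_an1`) and the constants rewritten into the hR frame (`Lc^(3+1) = Lc⁴`, `−(Lc^(3+1)·½·Lc^(3+1)) = −Lc⁸∕2`).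
* §3 **`axisReflectionCovariant_flipK_TbalOf_JsRowD1_of_letters`**: hR for `JsRowD1` ⟸ an1's mixed table law `hM` ∧ the pure-sign border statement `hInv`
  (+ `cΛ·Lc⁴ = 2`) — K-P `…_of_tableLaw_an1_suN` with lock2 DISCHARGED at the pin by `SpineRooted.lock2_of_bcj2` (file `SecondOrderLockPin`).
* §4 **`symmetries_JsRowD1_of_letters`**: hW ∧ hR for the ONE literal `JsRowD1`.
* §5 **`d1Drift_JsRowD1_of_letters_D1Tel_D1Rep`**: `D1Drift Lc (JsRowD1 hLc N cΛ cB) Nc μ ν` ⟸ EXACTLY {the five letters (+ the residual's class∕parity),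
  `D1Tel Lc (JsRowD1 …) Jc`, `D1Rep Lc Jc Nc μ ν a SL k`, B5 `h12`∕`h126`, window `(cc, M)`, `μ ≠ ν`, `Nc ≠ 0`, `2 ≤ Lc`, `2 ≤ N`, `cΛ·Lc⁴ = 2`} —
  `OneStepKernelFamily.d1Drift_of_D1Tel_D1Rep` at `Js := JsRowD1 hLc N cΛ cB`.  The colour parameter `Nc : ℝ` of `D1Drift` is LEFT FREE against the `SU(N)` of
  `T_W` (pin (P6) is the leads', not ruled here); `cB` is free (lockB `cB = −cVH²∕Lc⁴` is displayed by `SecondOrderLocks.lockB_iff`, not imposed).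
So the β-row D1 for the literal of record reads, in the kernel: **D1Drift ⟸ five displayed identities about an1's averaging tables ∧ D1Tel ∧ D1Rep** (+ printed
facts and bookkeeping data).  HONEST: none of the five letters, nor D1Tel, nor D1Rep is proved here or anywhere in the tree for these tables; 0∕4 binders.
Provenance: β sub-cell, unit beta-an2 gen 21, 2026-08-20 (v1); no existing file touched.

v1.1 (APPEND-ONLY, same gen; §1–§5 byte-identical): §6 the PINNED literal `JsRowD1Pin hLc N := JsRowD1 hLc N (2∕Lc⁴) (−Lc¹²∕4)` — the
Λ-lock value `cΛ·Lc⁴ = 2` (MX2's parity clause) and the lockB value `cB = −cVH²∕Lc⁴ = −Lc¹²∕4` (`SecondOrderLocks.lockB_iff`), the ONLY values at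
which the five letters can hold for an1's tables (exact-ℚ evidence, NOT theorems: an1-g28's ENGINE-B (border reflection, D ≤ 3) and the owner's
ENGINE-W (the three Ward letters, D ≤ 2; D = 3 job) fit `cB`, `cΛ` UNIQUELY to these values with zero residual) — with `symmetries_JsRowD1Pin_of_letters`
and `d1Drift_JsRowD1Pin_of_letters_D1Tel_D1Rep` (the Λ-lock hypothesis discharged by arithmetic); §7 the READ-OUT-LEVEL reading of the same row
(lead's `StepDriftWitness`): `d1Sum_JsRowD1_of_letters_D1Tel` (the five letters serve EXACTLY the step `D1Tel ⟹ D1Sum`) and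
`d1Drift_JsRowD1_of_d1Sum_D1Rep` (`D1Drift ⟸ D1Sum ∧ D1Rep`, NO letter) — so the letters and `D1Tel` enter the row only through `D1Sum`.
-/

open Finset
open scoped BigOperators
open Literature.MathematicalPhysics.QuantumFieldTheory
open Literature.MathematicalPhysics.QuantumFieldTheory.Balaban1983to89
open Literature.MathematicalPhysics.QuantumFieldTheory.Balaban1983to89.Beta
open Literature.MathematicalPhysics.QuantumFieldTheory.Balaban1983to89.Beta.VectorTailsLoc (fam kfam)
open Literature.MathematicalPhysics.QuantumFieldTheory.Balaban1983to89.Beta.VectorLegVolumeAdapter (MvE)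
open ExpKernelCalculus (MKer BiLoc VertexFamily comp shiftK)
open KernelWard (divV)
open AffineAveraging (box toSite)
open AveragingContoursRooted (ctr ctrOff ctrOff_mem_box)
open AveragingHessianKernelsRooted (vhSAt hessFFAt linKerAt)
open AveragingMixedJetTables (mixFFAt)
open PolarizationSign (reflSign WardTransversal AxisReflectionCovariant)
open KernelReflection (refK)
open ResolventReflection (bref Φ)
open OneStepResolventKernel (Fib JetData)
open OneStepKernelFamily (TbalOf flipK D1Tel D1Rep D1Drift d1Drift_of_D1Tel_D1Rep)
open StepDriftWitness (D1Sum d1Sum_of_d1Tel d1Drift_of_d1Sum_D1Rep)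
open WilsonVertex2Sym (wsym22)
open BalabanStepJetsSucc (wVH)
open BalabanStepW2 (M2Of)
open Summit.QuantumFields.BalabanUV.Beta.TameKernelCalculus
open Summit.QuantumFields.BalabanUV.Beta.BorderedHessian (diagK ctGen stepScale sgnK)
open Summit.QuantumFields.BalabanUV.Beta.AveragingWardRootedStencils (legInd)
open Summit.QuantumFields.BalabanUV.Beta.SpineRooted (M1At JsRecWAtOf lock2_of_bcj2)
open Summit.QuantumFields.BalabanUV.Beta.MixedJetTablesPlug (hmix_an1 hmixt_an1)
open Summit.QuantumFields.BalabanUV.Beta.SecondOrderBorderGauge (actB)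
open Summit.QuantumFields.BalabanUV.Beta.SecondOrderBorderModel (Twall)
open Summit.QuantumFields.BalabanUV.Beta.SecondOrderSocketIdentification (vh₂SAn1)
open Summit.QuantumFields.BalabanUV.Beta.SecondOrderTableLawEnd (locStencil₂_vh₂SAn1 vh₂SAn1_translate
  axisReflectionCovariant_flipK_TbalOf_JsRecWAtOf_of_tableLaw_an1_suN)
open Summit.QuantumFields.BalabanUV.Beta.WardLocusParityLevels (wardTransversal_flipK_TbalOf_JsRecWAtOf_TW_su_exact₀)

namespace Summit.QuantumFields.BalabanUV.Beta.RowD1JointEnd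

noncomputable section

variable {Lc : ℕ} [NeZero Lc]

/-! ## §1 The literal of record -/

/-- [our object] **THE STEP-JET LITERAL OF RECORD FOR BINDER ROW D1**: the recursive wall family v2.26-W over an1's TRUE averaging tables —
`JsRecWAtOf` at the centred root, odd `Lc`, pins `(cE, cVH, cE₂) = (Lc⁴, −Lc⁸∕2, Lc⁸)`, free `cΛ`, `cB`, Wilson table `T_W := (8N²)⁻¹ • wsym22 N`, border table
`vh₂SAn1 Lc` (through K-P's `locStencil₂_vh₂SAn1 hLc`), mixed table `mixFFAt ρ_c Lc` (through `hmix_an1`).  A NAME, nothing asserted. -/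
def JsRowD1 (hLc : Odd Lc) (N : ℕ) (cΛ cB : ℝ) : ℕ → JetData 3 Lc :=
  JsRecWAtOf (d := 3) hLc.pos (ctrOff_mem_box hLc.pos) ((Lc : ℝ) ^ 4) (-((Lc : ℝ) ^ 8 / 2)) cΛ ((Lc : ℝ) ^ 8) cB
    ((8 * (N : ℝ) ^ 2)⁻¹ • wsym22 N) (locStencil₂_vh₂SAn1 hLc) (hmix_an1 (d := 3) hLc.pos (ctrOff_mem_box hLc.pos))

/-- [folklore] `JsRowD1` unfolds to the displayed `JsRecWAtOf` literal (`rfl`). -/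
theorem JsRowD1_eq (hLc : Odd Lc) (N : ℕ) (cΛ cB : ℝ) :
    JsRowD1 hLc N cΛ cB = JsRecWAtOf (d := 3) hLc.pos (ctrOff_mem_box hLc.pos) ((Lc : ℝ) ^ 4) (-((Lc : ℝ) ^ 8 / 2)) cΛ ((Lc : ℝ) ^ 8) cB
      ((8 * (N : ℝ) ^ 2)⁻¹ • wsym22 N) (locStencil₂_vh₂SAn1 hLc) (hmix_an1 (d := 3) hLc.pos (ctrOff_mem_box hLc.pos)) := rfl

/-! ## §2 hW for the literal of record ⟸ the three level-0 Ward letters at an1's tables -/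

/-- [folklore] **hW FOR `JsRowD1` ⟸ leaf-06's THREE LEVEL-0 WARD LETTERS AT an1's TABLES** ((W-B₀) `hBord0` ∕ (W-B₀″) `hBord0''` for `vh₂SAn1 Lc`,
(W-M₀) `hM₂0` for `mixFFAt ρ_c Lc` with ONE residual table `RW₀` of `VertexFamily` class, row-parity-odd): `WardLocusParityLevels.…_TW_su_exact₀` at
`r := ctrOff 4 Lc`, `cE₂ := Lc⁸`, data hypotheses discharged, constants moved to the hR frame.  CONDITIONAL on the three letters. -/
theorem wardTransversal_flipK_TbalOf_JsRowD1_of_wardLetters (hLc : Odd Lc) {N : ℕ} (hN : 2 ≤ N) (cΛ cB : ℝ)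
    {RW₀ : (Fin (3 + 1) → ℤ) → Fin (3 + 1) → (Fin (3 + 1) → ℤ) → MKer (3 + 1) (Fib 3)}
    (hclsW₀ : ∃ C δ : ℝ, 0 < δ ∧ ∀ y, VertexFamily (RW₀ y) Lc C δ)
    (hRW₀p : ∀ y ρ' w, trK (RW₀ y ρ' w) = -sgnK (RW₀ y ρ' w))
    (hBord0 : ∀ (Y : Fin (3 + 1) → ℤ) (κ' : Fin (3 + 1)) (u' : Fin (3 + 1) → ℤ),
      (stepScale 3 Lc 0 * (Lc : ℝ) ^ (3 + 1))⁻¹ • ∑ v ∈ box (3 + 1) Lc, divV (fun κ u => cB • vh₂SAn1 Lc κ u κ' u') ((Lc : ℤ) • Y + toSite v) =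
        comp ((-((Lc : ℝ) ^ (3 + 1) * (1 / 2) * (Lc : ℝ) ^ (3 + 1))) • vhSAt (toSite (ctrOff 4 Lc)) 3 Lc rfl κ' u') (diagK (((1 : ℝ) / 2) • ∑ v ∈ box (3 + 1) Lc, legInd (toSite (ctrOff 4 Lc)) ((Lc : ℤ) • Y + toSite v)))
          - comp (diagK (((1 : ℝ) / 2) • ∑ v ∈ box (3 + 1) Lc, legInd (toSite (ctrOff 4 Lc)) ((Lc : ℤ) • Y + toSite v))) ((-((Lc : ℝ) ^ (3 + 1) * (1 / 2) * (Lc : ℝ) ^ (3 + 1))) • vhSAt (toSite (ctrOff 4 Lc)) 3 Lc rfl κ' u'))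
    (hBord0'' : ∀ (Y : Fin (3 + 1) → ℤ) (κ : Fin (3 + 1)) (u : Fin (3 + 1) → ℤ),
      (stepScale 3 Lc 0 * (Lc : ℝ) ^ (3 + 1))⁻¹ • ∑ v ∈ box (3 + 1) Lc, divV (fun κ' u' => cB • vh₂SAn1 Lc κ u κ' u') ((Lc : ℤ) • Y + toSite v) =
        comp ((-((Lc : ℝ) ^ (3 + 1) * (1 / 2) * (Lc : ℝ) ^ (3 + 1))) • vhSAt (toSite (ctrOff 4 Lc)) 3 Lc rfl κ u) (diagK (((1 : ℝ) / 2) • ∑ v ∈ box (3 + 1) Lc, legInd (toSite (ctrOff 4 Lc)) ((Lc : ℤ) • Y + toSite v)))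
          - comp (diagK (((1 : ℝ) / 2) • ∑ v ∈ box (3 + 1) Lc, legInd (toSite (ctrOff 4 Lc)) ((Lc : ℤ) • Y + toSite v))) ((-((Lc : ℝ) ^ (3 + 1) * (1 / 2) * (Lc : ℝ) ^ (3 + 1))) • vhSAt (toSite (ctrOff 4 Lc)) 3 Lc rfl κ u))
    (hM₂0 : ∀ (y : Fin (3 + 1) → ℤ) (ρ' : Fin (3 + 1)) (w : Fin (3 + 1) → ℤ),
      (stepScale 3 Lc 0 * (Lc : ℝ) ^ (3 + 1))⁻¹ • ∑ v ∈ box (3 + 1) Lc, divV (fun κ u => M2Of 3 Lc (mixFFAt (toSite (ctrOff 4 Lc)) Lc) 0 κ u ρ' w) ((Lc : ℤ) • y + toSite v) =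
        comp (M1At 3 Lc (toSite (ctrOff 4 Lc)) cΛ 0 ρ' w) (diagK (((1 : ℝ) / 2) • ∑ v ∈ box (3 + 1) Lc, legInd (toSite (ctrOff 4 Lc)) ((Lc : ℤ) • y + toSite v)))
          - comp (diagK (((1 : ℝ) / 2) • ∑ v ∈ box (3 + 1) Lc, legInd (toSite (ctrOff 4 Lc)) ((Lc : ℤ) • y + toSite v))) (M1At 3 Lc (toSite (ctrOff 4 Lc)) cΛ 0 ρ' w)
          + RW₀ y ρ' w) :
    ∀ j : ℕ, WardTransversal (flipK (TbalOf Lc (JsRowD1 hLc N cΛ cB) j)) := by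
  have h := wardTransversal_flipK_TbalOf_JsRecWAtOf_TW_su_exact₀ hN hLc.pos (ctrOff_mem_box hLc.pos) cΛ cB (cE₂ := (Lc : ℝ) ^ 8)
    (by norm_num) (locStencil₂_vh₂SAn1 hLc) (vh₂SAn1_translate hLc.pos) (hmix_an1 (d := 3) hLc.pos (ctrOff_mem_box hLc.pos))
    (hmixt_an1 (Lc := Lc) (toSite (ctrOff 4 Lc))) hclsW₀ hRW₀p hBord0 hBord0'' hM₂0
  have e2 : (-((Lc : ℝ) ^ (3 + 1) * (1 / 2) * (Lc : ℝ) ^ (3 + 1))) = -((Lc : ℝ) ^ 8 / 2) := by ring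
  have e1 : ((Lc : ℝ) ^ (3 + 1)) = (Lc : ℝ) ^ 4 := by norm_num
  rw [e2, e1] at h
  exact h

/-! ## §3 hR for the literal of record ⟸ an1's mixed table law ∧ the pure-sign border statement -/

/-- [folklore] **hR FOR `JsRowD1` ⟸ an1's TABLE-LEVEL MIXED LAW `hM` ∧ THE PURE-SIGN BORDER STATEMENT `hInv`** (+ `cΛ·Lc⁴ = 2`): K-P's `…_of_tableLaw_an1_suN`
with lock2 discharged at the pin `cE₂ = Lc⁸` (`SpineRooted.lock2_of_bcj2`, file `SecondOrderLockPin`).  CONDITIONAL on `hM` and `hInv`. -/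
theorem axisReflectionCovariant_flipK_TbalOf_JsRowD1_of_letters (hLc : Odd Lc) {N : ℕ} (hN : 2 ≤ N) {cΛ : ℝ}
    (hΛ : cΛ * (Lc : ℝ) ^ 4 = 2) (cB : ℝ) (γ : ℕ → ℝ)
    (hγ : ∀ j, γ j = -((Lc : ℝ) ^ 8 / 2) * wVH 3 Lc j / (stepScale 3 Lc j * (Lc : ℝ) ^ 4))
    (hM : ∀ (α κ : Fin 4) (u : Fin 4 → ℤ) (ρ' : Fin 4) (w : Fin 4 → ℤ),
      mixFFAt (toSite (ctrOff 4 Lc)) Lc κ (bref α κ u) ρ' (bref α ρ' w) =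
        (reflSign α κ * reflSign α ρ') • refK (Φ Lc α)
          (mixFFAt (toSite (ctrOff 4 Lc)) Lc κ u ρ' w
            + (2 : ℝ) • comp (diagK (ctGen 3 α Lc κ u)) (hessFFAt (toSite (ctrOff 4 Lc)) Lc ρ' w)
            + (2 * (if ρ' = α then linKerAt (toSite (ctrOff 4 Lc)) Lc ρ' w (κ, u) else 0)) • hessFFAt (toSite (ctrOff 4 Lc)) Lc ρ' w))
    (hInv : ∀ (α κ : Fin 4) (u : Fin 4 → ℤ) (κ' : Fin 4) (u' x z : Fin 4 → ℤ) (β m : Fin 4),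
      (actB Lc α (cB • vh₂SAn1 Lc - Twall Lc cΛ γ) - (cB • vh₂SAn1 Lc - Twall Lc cΛ γ)) κ u κ' u' x z (Sum.inl β) (Sum.inr m) = 0) :
    ∀ j : ℕ, AxisReflectionCovariant (flipK (TbalOf Lc (JsRowD1 hLc N cΛ cB) j)) :=
  axisReflectionCovariant_flipK_TbalOf_JsRecWAtOf_of_tableLaw_an1_suN hLc hN hΛ ((Lc : ℝ) ^ 8) cB γ hγ
    (fun j => lock2_of_bcj2 ((Lc : ℝ) ^ 8) rfl j) hM hInv

/-! ## §4 Both symmetry binders for the ONE literal -/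

/-- [folklore] **hW ∧ hR FOR THE ONE LITERAL `JsRowD1`** from the displayed letters of both sides (+ `cΛ·Lc⁴ = 2`).  CONDITIONAL on every letter. -/
theorem symmetries_JsRowD1_of_letters (hLc : Odd Lc) {N : ℕ} (hN : 2 ≤ N) {cΛ : ℝ} (hΛ : cΛ * (Lc : ℝ) ^ 4 = 2) (cB : ℝ)
    (γ : ℕ → ℝ) (hγ : ∀ j, γ j = -((Lc : ℝ) ^ 8 / 2) * wVH 3 Lc j / (stepScale 3 Lc j * (Lc : ℝ) ^ 4))
    -- hR-side letters (an1's tables; targets of an3's M4 ∕ M5)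
    (hM : ∀ (α κ : Fin 4) (u : Fin 4 → ℤ) (ρ' : Fin 4) (w : Fin 4 → ℤ),
      mixFFAt (toSite (ctrOff 4 Lc)) Lc κ (bref α κ u) ρ' (bref α ρ' w) =
        (reflSign α κ * reflSign α ρ') • refK (Φ Lc α)
          (mixFFAt (toSite (ctrOff 4 Lc)) Lc κ u ρ' w
            + (2 : ℝ) • comp (diagK (ctGen 3 α Lc κ u)) (hessFFAt (toSite (ctrOff 4 Lc)) Lc ρ' w)
            + (2 * (if ρ' = α then linKerAt (toSite (ctrOff 4 Lc)) Lc ρ' w (κ, u) else 0)) • hessFFAt (toSite (ctrOff 4 Lc)) Lc ρ' w))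
    (hInv : ∀ (α κ : Fin 4) (u : Fin 4 → ℤ) (κ' : Fin 4) (u' x z : Fin 4 → ℤ) (β m : Fin 4),
      (actB Lc α (cB • vh₂SAn1 Lc - Twall Lc cΛ γ) - (cB • vh₂SAn1 Lc - Twall Lc cΛ γ)) κ u κ' u' x z (Sum.inl β) (Sum.inr m) = 0)
    -- hW-side letters (leaf-06's level-0 Ward letters at an1's tables)
    {RW₀ : (Fin (3 + 1) → ℤ) → Fin (3 + 1) → (Fin (3 + 1) → ℤ) → MKer (3 + 1) (Fib 3)}
    (hclsW₀ : ∃ C δ : ℝ, 0 < δ ∧ ∀ y, VertexFamily (RW₀ y) Lc C δ)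
    (hRW₀p : ∀ y ρ' w, trK (RW₀ y ρ' w) = -sgnK (RW₀ y ρ' w))
    (hBord0 : ∀ (Y : Fin (3 + 1) → ℤ) (κ' : Fin (3 + 1)) (u' : Fin (3 + 1) → ℤ),
      (stepScale 3 Lc 0 * (Lc : ℝ) ^ (3 + 1))⁻¹ • ∑ v ∈ box (3 + 1) Lc, divV (fun κ u => cB • vh₂SAn1 Lc κ u κ' u') ((Lc : ℤ) • Y + toSite v) =
        comp ((-((Lc : ℝ) ^ (3 + 1) * (1 / 2) * (Lc : ℝ) ^ (3 + 1))) • vhSAt (toSite (ctrOff 4 Lc)) 3 Lc rfl κ' u') (diagK (((1 : ℝ) / 2) • ∑ v ∈ box (3 + 1) Lc, legInd (toSite (ctrOff 4 Lc)) ((Lc : ℤ) • Y + toSite v)))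
          - comp (diagK (((1 : ℝ) / 2) • ∑ v ∈ box (3 + 1) Lc, legInd (toSite (ctrOff 4 Lc)) ((Lc : ℤ) • Y + toSite v))) ((-((Lc : ℝ) ^ (3 + 1) * (1 / 2) * (Lc : ℝ) ^ (3 + 1))) • vhSAt (toSite (ctrOff 4 Lc)) 3 Lc rfl κ' u'))
    (hBord0'' : ∀ (Y : Fin (3 + 1) → ℤ) (κ : Fin (3 + 1)) (u : Fin (3 + 1) → ℤ),
      (stepScale 3 Lc 0 * (Lc : ℝ) ^ (3 + 1))⁻¹ • ∑ v ∈ box (3 + 1) Lc, divV (fun κ' u' => cB • vh₂SAn1 Lc κ u κ' u') ((Lc : ℤ) • Y + toSite v) =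
        comp ((-((Lc : ℝ) ^ (3 + 1) * (1 / 2) * (Lc : ℝ) ^ (3 + 1))) • vhSAt (toSite (ctrOff 4 Lc)) 3 Lc rfl κ u) (diagK (((1 : ℝ) / 2) • ∑ v ∈ box (3 + 1) Lc, legInd (toSite (ctrOff 4 Lc)) ((Lc : ℤ) • Y + toSite v)))
          - comp (diagK (((1 : ℝ) / 2) • ∑ v ∈ box (3 + 1) Lc, legInd (toSite (ctrOff 4 Lc)) ((Lc : ℤ) • Y + toSite v))) ((-((Lc : ℝ) ^ (3 + 1) * (1 / 2) * (Lc : ℝ) ^ (3 + 1))) • vhSAt (toSite (ctrOff 4 Lc)) 3 Lc rfl κ u))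
    (hM₂0 : ∀ (y : Fin (3 + 1) → ℤ) (ρ' : Fin (3 + 1)) (w : Fin (3 + 1) → ℤ),
      (stepScale 3 Lc 0 * (Lc : ℝ) ^ (3 + 1))⁻¹ • ∑ v ∈ box (3 + 1) Lc, divV (fun κ u => M2Of 3 Lc (mixFFAt (toSite (ctrOff 4 Lc)) Lc) 0 κ u ρ' w) ((Lc : ℤ) • y + toSite v) =
        comp (M1At 3 Lc (toSite (ctrOff 4 Lc)) cΛ 0 ρ' w) (diagK (((1 : ℝ) / 2) • ∑ v ∈ box (3 + 1) Lc, legInd (toSite (ctrOff 4 Lc)) ((Lc : ℤ) • y + toSite v)))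
          - comp (diagK (((1 : ℝ) / 2) • ∑ v ∈ box (3 + 1) Lc, legInd (toSite (ctrOff 4 Lc)) ((Lc : ℤ) • y + toSite v))) (M1At 3 Lc (toSite (ctrOff 4 Lc)) cΛ 0 ρ' w)
          + RW₀ y ρ' w) :
    (∀ j : ℕ, WardTransversal (flipK (TbalOf Lc (JsRowD1 hLc N cΛ cB) j)))
      ∧ (∀ j : ℕ, AxisReflectionCovariant (flipK (TbalOf Lc (JsRowD1 hLc N cΛ cB) j))) :=
  ⟨wardTransversal_flipK_TbalOf_JsRowD1_of_wardLetters hLc hN cΛ cB hclsW₀ hRW₀p hBord0 hBord0'' hM₂0,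
    axisReflectionCovariant_flipK_TbalOf_JsRowD1_of_letters hLc hN hΛ cB γ hγ hM hInv⟩

/-! ## §5 The row's END: `D1Drift` for the literal of record ⟸ letters ∧ D1Tel ∧ D1Rep (+ printed facts, window) -/

/-- [folklore] **ROW D1 FOR THE LITERAL OF RECORD, AS ONE KERNEL STATEMENT**: `D1Drift Lc (JsRowD1 hLc N cΛ cB) Nc μ ν` — the one-loop
coefficients `β⁰_j := secondMoment (TbalOf Lc (JsRowD1 …) j) μ ν` drift with slope `stepBal Nc Lc` up to a bounded cumulative defect — from EXACTLY:
the five displayed letters about an1's averaging tables (`hM`, `hInv`; `hBord0`, `hBord0''`, `hM₂0` + the residual's class∕parity), `D1Tel Lc (JsRowD1 …) Jc`,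
`D1Rep Lc Jc Nc μ ν a SL k`, the printed B5 facts `h12`∕`h126`, the window data `(cc, M)`, `μ ≠ ν`, `Nc ≠ 0`, `2 ≤ Lc`, odd `Lc`, `2 ≤ N`, `cΛ·Lc⁴ = 2` —
`OneStepKernelFamily.d1Drift_of_D1Tel_D1Rep` at `Js := JsRowD1 hLc N cΛ cB` with hW∕hR supplied by §4.  `Nc` (colour parameter of the slope) is NOT pinned to `N`
here ((P6) is the leads').  CONDITIONAL; discharges nothing of `BetaPertH`. -/
theorem d1Drift_JsRowD1_of_letters_D1Tel_D1Rep (hLc : Odd Lc) (hL2 : 2 ≤ Lc) {N : ℕ} (hN : 2 ≤ N) {cΛ : ℝ}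
    (hΛ : cΛ * (Lc : ℝ) ^ 4 = 2) (cB : ℝ)
    (γ : ℕ → ℝ) (hγ : ∀ j, γ j = -((Lc : ℝ) ^ 8 / 2) * wVH 3 Lc j / (stepScale 3 Lc j * (Lc : ℝ) ^ 4))
    -- hR-side letters
    (hM : ∀ (α κ : Fin 4) (u : Fin 4 → ℤ) (ρ' : Fin 4) (w : Fin 4 → ℤ),
      mixFFAt (toSite (ctrOff 4 Lc)) Lc κ (bref α κ u) ρ' (bref α ρ' w) =
        (reflSign α κ * reflSign α ρ') • refK (Φ Lc α)
          (mixFFAt (toSite (ctrOff 4 Lc)) Lc κ u ρ' w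
            + (2 : ℝ) • comp (diagK (ctGen 3 α Lc κ u)) (hessFFAt (toSite (ctrOff 4 Lc)) Lc ρ' w)
            + (2 * (if ρ' = α then linKerAt (toSite (ctrOff 4 Lc)) Lc ρ' w (κ, u) else 0)) • hessFFAt (toSite (ctrOff 4 Lc)) Lc ρ' w))
    (hInv : ∀ (α κ : Fin 4) (u : Fin 4 → ℤ) (κ' : Fin 4) (u' x z : Fin 4 → ℤ) (β m : Fin 4),
      (actB Lc α (cB • vh₂SAn1 Lc - Twall Lc cΛ γ) - (cB • vh₂SAn1 Lc - Twall Lc cΛ γ)) κ u κ' u' x z (Sum.inl β) (Sum.inr m) = 0)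
    -- hW-side letters
    {RW₀ : (Fin (3 + 1) → ℤ) → Fin (3 + 1) → (Fin (3 + 1) → ℤ) → MKer (3 + 1) (Fib 3)}
    (hclsW₀ : ∃ C δ : ℝ, 0 < δ ∧ ∀ y, VertexFamily (RW₀ y) Lc C δ)
    (hRW₀p : ∀ y ρ' w, trK (RW₀ y ρ' w) = -sgnK (RW₀ y ρ' w))
    (hBord0 : ∀ (Y : Fin (3 + 1) → ℤ) (κ' : Fin (3 + 1)) (u' : Fin (3 + 1) → ℤ),
      (stepScale 3 Lc 0 * (Lc : ℝ) ^ (3 + 1))⁻¹ • ∑ v ∈ box (3 + 1) Lc, divV (fun κ u => cB • vh₂SAn1 Lc κ u κ' u') ((Lc : ℤ) • Y + toSite v) =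
        comp ((-((Lc : ℝ) ^ (3 + 1) * (1 / 2) * (Lc : ℝ) ^ (3 + 1))) • vhSAt (toSite (ctrOff 4 Lc)) 3 Lc rfl κ' u') (diagK (((1 : ℝ) / 2) • ∑ v ∈ box (3 + 1) Lc, legInd (toSite (ctrOff 4 Lc)) ((Lc : ℤ) • Y + toSite v)))
          - comp (diagK (((1 : ℝ) / 2) • ∑ v ∈ box (3 + 1) Lc, legInd (toSite (ctrOff 4 Lc)) ((Lc : ℤ) • Y + toSite v))) ((-((Lc : ℝ) ^ (3 + 1) * (1 / 2) * (Lc : ℝ) ^ (3 + 1))) • vhSAt (toSite (ctrOff 4 Lc)) 3 Lc rfl κ' u'))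
    (hBord0'' : ∀ (Y : Fin (3 + 1) → ℤ) (κ : Fin (3 + 1)) (u : Fin (3 + 1) → ℤ),
      (stepScale 3 Lc 0 * (Lc : ℝ) ^ (3 + 1))⁻¹ • ∑ v ∈ box (3 + 1) Lc, divV (fun κ' u' => cB • vh₂SAn1 Lc κ u κ' u') ((Lc : ℤ) • Y + toSite v) =
        comp ((-((Lc : ℝ) ^ (3 + 1) * (1 / 2) * (Lc : ℝ) ^ (3 + 1))) • vhSAt (toSite (ctrOff 4 Lc)) 3 Lc rfl κ u) (diagK (((1 : ℝ) / 2) • ∑ v ∈ box (3 + 1) Lc, legInd (toSite (ctrOff 4 Lc)) ((Lc : ℤ) • Y + toSite v)))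
          - comp (diagK (((1 : ℝ) / 2) • ∑ v ∈ box (3 + 1) Lc, legInd (toSite (ctrOff 4 Lc)) ((Lc : ℤ) • Y + toSite v))) ((-((Lc : ℝ) ^ (3 + 1) * (1 / 2) * (Lc : ℝ) ^ (3 + 1))) • vhSAt (toSite (ctrOff 4 Lc)) 3 Lc rfl κ u))
    (hM₂0 : ∀ (y : Fin (3 + 1) → ℤ) (ρ' : Fin (3 + 1)) (w : Fin (3 + 1) → ℤ),
      (stepScale 3 Lc 0 * (Lc : ℝ) ^ (3 + 1))⁻¹ • ∑ v ∈ box (3 + 1) Lc, divV (fun κ u => M2Of 3 Lc (mixFFAt (toSite (ctrOff 4 Lc)) Lc) 0 κ u ρ' w) ((Lc : ℤ) • y + toSite v) =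
        comp (M1At 3 Lc (toSite (ctrOff 4 Lc)) cΛ 0 ρ' w) (diagK (((1 : ℝ) / 2) • ∑ v ∈ box (3 + 1) Lc, legInd (toSite (ctrOff 4 Lc)) ((Lc : ℤ) • y + toSite v)))
          - comp (diagK (((1 : ℝ) / 2) • ∑ v ∈ box (3 + 1) Lc, legInd (toSite (ctrOff 4 Lc)) ((Lc : ℤ) • y + toSite v))) (M1At 3 Lc (toSite (ctrOff 4 Lc)) cΛ 0 ρ' w)
          + RW₀ y ρ' w)
    -- the route theorem's own binders (printed B5 facts, channel, colour parameter, window), verbatim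
    (a : ℝ) (ha : 0 < a)
    (h12 : B5.Prop12Printed (fam (fun i : ℕ+ × ℕ => ((i.1 : ℕ+) : ℕ)) (fun i => i.1.pos) MvE a ha))
    (h126 : B5.Kernel126_127Printed (kfam (fun i : ℕ+ × ℕ => ((i.1 : ℕ+) : ℕ)) MvE))
    {L : Type*} {SL : Finset L} (hSL : SL.Nonempty) (k : L → Fin 4) {μ ν : Fin 4} (hμν : μ ≠ ν) {Nc : ℝ} (hNc : Nc ≠ 0)
    (Jc : ∀ m : ℕ, JetData 3 (Lc ^ m)) (htel : D1Tel Lc (JsRowD1 hLc N cΛ cB) Jc)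
    {cc : ℝ} {M : ℕ → ℕ} (hc : 1 ≤ cc) (hMw : ∀ L : ℕ, 2 ≤ L → 1 ≤ M L ∧ (L : ℝ) ≤ cc * M L) (hML : ∀ L : ℕ, 2 ≤ L → M L ≤ L)
    (hrep : D1Rep Lc Jc Nc μ ν a SL k) :
    D1Drift Lc (JsRowD1 hLc N cΛ cB) Nc μ ν := by
  obtain ⟨hW, hR⟩ := symmetries_JsRowD1_of_letters hLc hN hΛ cB γ hγ hM hInv hclsW₀ hRW₀p hBord0 hBord0'' hM₂0
  exact d1Drift_of_D1Tel_D1Rep a ha h12 h126 hSL k hμν hNc hL2 (JsRowD1 hLc N cΛ cB) Jc hW hR htel hc hMw hML hrep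

/-! ## §6 (v1.1) The PINNED literal of record: `cΛ := 2∕Lc⁴`, `cB := −Lc¹²∕4` -/

/-- [our object] **THE PINNED LITERAL OF RECORD** `JsRowD1Pin hLc N := JsRowD1 hLc N (2∕Lc⁴) (−Lc¹²∕4)`: the Λ-lock value (`cΛ·Lc⁴ = 2`,
MX2's parity clause) and the lockB value (`cB = −cVH²∕Lc⁴`, `SecondOrderLocks.lockB_iff`) — the only values at which the five letters can hold for
an1's tables (exact-ℚ toy evidence ENGINE-B(an1) ∕ ENGINE-W(owner), NOT theorems).  A NAME; nothing asserted. -/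
def JsRowD1Pin (hLc : Odd Lc) (N : ℕ) : ℕ → JetData 3 Lc :=
  JsRowD1 hLc N (2 / (Lc : ℝ) ^ 4) (-((Lc : ℝ) ^ 12 / 4))

/-- [folklore] `JsRowD1Pin` unfolds to `JsRowD1` at the pinned constants (`rfl`). -/
theorem JsRowD1Pin_eq (hLc : Odd Lc) (N : ℕ) : JsRowD1Pin hLc N = JsRowD1 hLc N (2 / (Lc : ℝ) ^ 4) (-((Lc : ℝ) ^ 12 / 4)) := rfl

omit [NeZero Lc] in
/-- [folklore] The Λ-lock arithmetic at the pin: `(2∕Lc⁴)·Lc⁴ = 2` (`Lc ≠ 0`). -/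
theorem lockΛ_pin (hLc : Odd Lc) : 2 / (Lc : ℝ) ^ 4 * (Lc : ℝ) ^ 4 = 2 := by
  have hL : (Lc : ℝ) ≠ 0 := by exact_mod_cast hLc.pos.ne'
  field_simp

/-- [folklore] **hW ∧ hR FOR THE PINNED LITERAL `JsRowD1Pin`** from the five displayed letters AT THE PINNED CONSTANTS (no lock hypothesis left).
CONDITIONAL on every letter. -/
theorem symmetries_JsRowD1Pin_of_letters (hLc : Odd Lc) {N : ℕ} (hN : 2 ≤ N)
    (γ : ℕ → ℝ) (hγ : ∀ j, γ j = -((Lc : ℝ) ^ 8 / 2) * wVH 3 Lc j / (stepScale 3 Lc j * (Lc : ℝ) ^ 4))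
    -- hR-side letters at (cΛ, cB) := (2∕Lc⁴, −Lc¹²∕4)
    (hM : ∀ (α κ : Fin 4) (u : Fin 4 → ℤ) (ρ' : Fin 4) (w : Fin 4 → ℤ),
      mixFFAt (toSite (ctrOff 4 Lc)) Lc κ (bref α κ u) ρ' (bref α ρ' w) =
        (reflSign α κ * reflSign α ρ') • refK (Φ Lc α)
          (mixFFAt (toSite (ctrOff 4 Lc)) Lc κ u ρ' w
            + (2 : ℝ) • comp (diagK (ctGen 3 α Lc κ u)) (hessFFAt (toSite (ctrOff 4 Lc)) Lc ρ' w)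
            + (2 * (if ρ' = α then linKerAt (toSite (ctrOff 4 Lc)) Lc ρ' w (κ, u) else 0)) • hessFFAt (toSite (ctrOff 4 Lc)) Lc ρ' w))
    (hInv : ∀ (α κ : Fin 4) (u : Fin 4 → ℤ) (κ' : Fin 4) (u' x z : Fin 4 → ℤ) (β m : Fin 4),
      (actB Lc α ((-((Lc : ℝ) ^ 12 / 4)) • vh₂SAn1 Lc - Twall Lc (2 / (Lc : ℝ) ^ 4) γ)
        - ((-((Lc : ℝ) ^ 12 / 4)) • vh₂SAn1 Lc - Twall Lc (2 / (Lc : ℝ) ^ 4) γ)) κ u κ' u' x z (Sum.inl β) (Sum.inr m) = 0)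
    -- hW-side letters at (cΛ, cB) := (2∕Lc⁴, −Lc¹²∕4)
    {RW₀ : (Fin (3 + 1) → ℤ) → Fin (3 + 1) → (Fin (3 + 1) → ℤ) → MKer (3 + 1) (Fib 3)}
    (hclsW₀ : ∃ C δ : ℝ, 0 < δ ∧ ∀ y, VertexFamily (RW₀ y) Lc C δ)
    (hRW₀p : ∀ y ρ' w, trK (RW₀ y ρ' w) = -sgnK (RW₀ y ρ' w))
    (hBord0 : ∀ (Y : Fin (3 + 1) → ℤ) (κ' : Fin (3 + 1)) (u' : Fin (3 + 1) → ℤ),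
      (stepScale 3 Lc 0 * (Lc : ℝ) ^ (3 + 1))⁻¹ • ∑ v ∈ box (3 + 1) Lc, divV (fun κ u => (-((Lc : ℝ) ^ 12 / 4)) • vh₂SAn1 Lc κ u κ' u') ((Lc : ℤ) • Y + toSite v) =
        comp ((-((Lc : ℝ) ^ (3 + 1) * (1 / 2) * (Lc : ℝ) ^ (3 + 1))) • vhSAt (toSite (ctrOff 4 Lc)) 3 Lc rfl κ' u') (diagK (((1 : ℝ) / 2) • ∑ v ∈ box (3 + 1) Lc, legInd (toSite (ctrOff 4 Lc)) ((Lc : ℤ) • Y + toSite v)))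
          - comp (diagK (((1 : ℝ) / 2) • ∑ v ∈ box (3 + 1) Lc, legInd (toSite (ctrOff 4 Lc)) ((Lc : ℤ) • Y + toSite v))) ((-((Lc : ℝ) ^ (3 + 1) * (1 / 2) * (Lc : ℝ) ^ (3 + 1))) • vhSAt (toSite (ctrOff 4 Lc)) 3 Lc rfl κ' u'))
    (hBord0'' : ∀ (Y : Fin (3 + 1) → ℤ) (κ : Fin (3 + 1)) (u : Fin (3 + 1) → ℤ),
      (stepScale 3 Lc 0 * (Lc : ℝ) ^ (3 + 1))⁻¹ • ∑ v ∈ box (3 + 1) Lc, divV (fun κ' u' => (-((Lc : ℝ) ^ 12 / 4)) • vh₂SAn1 Lc κ u κ' u') ((Lc : ℤ) • Y + toSite v) =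
        comp ((-((Lc : ℝ) ^ (3 + 1) * (1 / 2) * (Lc : ℝ) ^ (3 + 1))) • vhSAt (toSite (ctrOff 4 Lc)) 3 Lc rfl κ u) (diagK (((1 : ℝ) / 2) • ∑ v ∈ box (3 + 1) Lc, legInd (toSite (ctrOff 4 Lc)) ((Lc : ℤ) • Y + toSite v)))
          - comp (diagK (((1 : ℝ) / 2) • ∑ v ∈ box (3 + 1) Lc, legInd (toSite (ctrOff 4 Lc)) ((Lc : ℤ) • Y + toSite v))) ((-((Lc : ℝ) ^ (3 + 1) * (1 / 2) * (Lc : ℝ) ^ (3 + 1))) • vhSAt (toSite (ctrOff 4 Lc)) 3 Lc rfl κ u))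
    (hM₂0 : ∀ (y : Fin (3 + 1) → ℤ) (ρ' : Fin (3 + 1)) (w : Fin (3 + 1) → ℤ),
      (stepScale 3 Lc 0 * (Lc : ℝ) ^ (3 + 1))⁻¹ • ∑ v ∈ box (3 + 1) Lc, divV (fun κ u => M2Of 3 Lc (mixFFAt (toSite (ctrOff 4 Lc)) Lc) 0 κ u ρ' w) ((Lc : ℤ) • y + toSite v) =
        comp (M1At 3 Lc (toSite (ctrOff 4 Lc)) (2 / (Lc : ℝ) ^ 4) 0 ρ' w) (diagK (((1 : ℝ) / 2) • ∑ v ∈ box (3 + 1) Lc, legInd (toSite (ctrOff 4 Lc)) ((Lc : ℤ) • y + toSite v)))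
          - comp (diagK (((1 : ℝ) / 2) • ∑ v ∈ box (3 + 1) Lc, legInd (toSite (ctrOff 4 Lc)) ((Lc : ℤ) • y + toSite v))) (M1At 3 Lc (toSite (ctrOff 4 Lc)) (2 / (Lc : ℝ) ^ 4) 0 ρ' w)
          + RW₀ y ρ' w) :
    (∀ j : ℕ, WardTransversal (flipK (TbalOf Lc (JsRowD1Pin hLc N) j)))
      ∧ (∀ j : ℕ, AxisReflectionCovariant (flipK (TbalOf Lc (JsRowD1Pin hLc N) j))) :=
  symmetries_JsRowD1_of_letters hLc hN (lockΛ_pin hLc) (-((Lc : ℝ) ^ 12 / 4)) γ hγ hM hInv hclsW₀ hRW₀p hBord0 hBord0'' hM₂0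

/-- [folklore] **ROW D1 FOR THE PINNED LITERAL, ONE KERNEL STATEMENT**: `D1Drift Lc (JsRowD1Pin hLc N) Nc μ ν` ⟸ the five letters at the pinned
constants ∧ `D1Tel Lc (JsRowD1Pin hLc N) Jc` ∧ `D1Rep Lc Jc Nc μ ν a SL k` (+ printed B5 facts, window, `μ ≠ ν`, `Nc ≠ 0`, `2 ≤ Lc` odd, `2 ≤ N`).
CONDITIONAL; `Nc` not pinned to `N` ((P6)). -/
theorem d1Drift_JsRowD1Pin_of_letters_D1Tel_D1Rep (hLc : Odd Lc) (hL2 : 2 ≤ Lc) {N : ℕ} (hN : 2 ≤ N)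
    (γ : ℕ → ℝ) (hγ : ∀ j, γ j = -((Lc : ℝ) ^ 8 / 2) * wVH 3 Lc j / (stepScale 3 Lc j * (Lc : ℝ) ^ 4))
    (hM : ∀ (α κ : Fin 4) (u : Fin 4 → ℤ) (ρ' : Fin 4) (w : Fin 4 → ℤ),
      mixFFAt (toSite (ctrOff 4 Lc)) Lc κ (bref α κ u) ρ' (bref α ρ' w) =
        (reflSign α κ * reflSign α ρ') • refK (Φ Lc α)
          (mixFFAt (toSite (ctrOff 4 Lc)) Lc κ u ρ' w
            + (2 : ℝ) • comp (diagK (ctGen 3 α Lc κ u)) (hessFFAt (toSite (ctrOff 4 Lc)) Lc ρ' w)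
            + (2 * (if ρ' = α then linKerAt (toSite (ctrOff 4 Lc)) Lc ρ' w (κ, u) else 0)) • hessFFAt (toSite (ctrOff 4 Lc)) Lc ρ' w))
    (hInv : ∀ (α κ : Fin 4) (u : Fin 4 → ℤ) (κ' : Fin 4) (u' x z : Fin 4 → ℤ) (β m : Fin 4),
      (actB Lc α ((-((Lc : ℝ) ^ 12 / 4)) • vh₂SAn1 Lc - Twall Lc (2 / (Lc : ℝ) ^ 4) γ)
        - ((-((Lc : ℝ) ^ 12 / 4)) • vh₂SAn1 Lc - Twall Lc (2 / (Lc : ℝ) ^ 4) γ)) κ u κ' u' x z (Sum.inl β) (Sum.inr m) = 0)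
    {RW₀ : (Fin (3 + 1) → ℤ) → Fin (3 + 1) → (Fin (3 + 1) → ℤ) → MKer (3 + 1) (Fib 3)}
    (hclsW₀ : ∃ C δ : ℝ, 0 < δ ∧ ∀ y, VertexFamily (RW₀ y) Lc C δ)
    (hRW₀p : ∀ y ρ' w, trK (RW₀ y ρ' w) = -sgnK (RW₀ y ρ' w))
    (hBord0 : ∀ (Y : Fin (3 + 1) → ℤ) (κ' : Fin (3 + 1)) (u' : Fin (3 + 1) → ℤ),
      (stepScale 3 Lc 0 * (Lc : ℝ) ^ (3 + 1))⁻¹ • ∑ v ∈ box (3 + 1) Lc, divV (fun κ u => (-((Lc : ℝ) ^ 12 / 4)) • vh₂SAn1 Lc κ u κ' u') ((Lc : ℤ) • Y + toSite v) =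
        comp ((-((Lc : ℝ) ^ (3 + 1) * (1 / 2) * (Lc : ℝ) ^ (3 + 1))) • vhSAt (toSite (ctrOff 4 Lc)) 3 Lc rfl κ' u') (diagK (((1 : ℝ) / 2) • ∑ v ∈ box (3 + 1) Lc, legInd (toSite (ctrOff 4 Lc)) ((Lc : ℤ) • Y + toSite v)))
          - comp (diagK (((1 : ℝ) / 2) • ∑ v ∈ box (3 + 1) Lc, legInd (toSite (ctrOff 4 Lc)) ((Lc : ℤ) • Y + toSite v))) ((-((Lc : ℝ) ^ (3 + 1) * (1 / 2) * (Lc : ℝ) ^ (3 + 1))) • vhSAt (toSite (ctrOff 4 Lc)) 3 Lc rfl κ' u'))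
    (hBord0'' : ∀ (Y : Fin (3 + 1) → ℤ) (κ : Fin (3 + 1)) (u : Fin (3 + 1) → ℤ),
      (stepScale 3 Lc 0 * (Lc : ℝ) ^ (3 + 1))⁻¹ • ∑ v ∈ box (3 + 1) Lc, divV (fun κ' u' => (-((Lc : ℝ) ^ 12 / 4)) • vh₂SAn1 Lc κ u κ' u') ((Lc : ℤ) • Y + toSite v) =
        comp ((-((Lc : ℝ) ^ (3 + 1) * (1 / 2) * (Lc : ℝ) ^ (3 + 1))) • vhSAt (toSite (ctrOff 4 Lc)) 3 Lc rfl κ u) (diagK (((1 : ℝ) / 2) • ∑ v ∈ box (3 + 1) Lc, legInd (toSite (ctrOff 4 Lc)) ((Lc : ℤ) • Y + toSite v)))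
          - comp (diagK (((1 : ℝ) / 2) • ∑ v ∈ box (3 + 1) Lc, legInd (toSite (ctrOff 4 Lc)) ((Lc : ℤ) • Y + toSite v))) ((-((Lc : ℝ) ^ (3 + 1) * (1 / 2) * (Lc : ℝ) ^ (3 + 1))) • vhSAt (toSite (ctrOff 4 Lc)) 3 Lc rfl κ u))
    (hM₂0 : ∀ (y : Fin (3 + 1) → ℤ) (ρ' : Fin (3 + 1)) (w : Fin (3 + 1) → ℤ),
      (stepScale 3 Lc 0 * (Lc : ℝ) ^ (3 + 1))⁻¹ • ∑ v ∈ box (3 + 1) Lc, divV (fun κ u => M2Of 3 Lc (mixFFAt (toSite (ctrOff 4 Lc)) Lc) 0 κ u ρ' w) ((Lc : ℤ) • y + toSite v) =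
        comp (M1At 3 Lc (toSite (ctrOff 4 Lc)) (2 / (Lc : ℝ) ^ 4) 0 ρ' w) (diagK (((1 : ℝ) / 2) • ∑ v ∈ box (3 + 1) Lc, legInd (toSite (ctrOff 4 Lc)) ((Lc : ℤ) • y + toSite v)))
          - comp (diagK (((1 : ℝ) / 2) • ∑ v ∈ box (3 + 1) Lc, legInd (toSite (ctrOff 4 Lc)) ((Lc : ℤ) • y + toSite v))) (M1At 3 Lc (toSite (ctrOff 4 Lc)) (2 / (Lc : ℝ) ^ 4) 0 ρ' w)
          + RW₀ y ρ' w)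
    (a : ℝ) (ha : 0 < a)
    (h12 : B5.Prop12Printed (fam (fun i : ℕ+ × ℕ => ((i.1 : ℕ+) : ℕ)) (fun i => i.1.pos) MvE a ha))
    (h126 : B5.Kernel126_127Printed (kfam (fun i : ℕ+ × ℕ => ((i.1 : ℕ+) : ℕ)) MvE))
    {L : Type*} {SL : Finset L} (hSL : SL.Nonempty) (k : L → Fin 4) {μ ν : Fin 4} (hμν : μ ≠ ν) {Nc : ℝ} (hNc : Nc ≠ 0)
    (Jc : ∀ m : ℕ, JetData 3 (Lc ^ m)) (htel : D1Tel Lc (JsRowD1Pin hLc N) Jc)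
    {cc : ℝ} {M : ℕ → ℕ} (hc : 1 ≤ cc) (hMw : ∀ L : ℕ, 2 ≤ L → 1 ≤ M L ∧ (L : ℝ) ≤ cc * M L) (hML : ∀ L : ℕ, 2 ≤ L → M L ≤ L)
    (hrep : D1Rep Lc Jc Nc μ ν a SL k) :
    D1Drift Lc (JsRowD1Pin hLc N) Nc μ ν :=
  d1Drift_JsRowD1_of_letters_D1Tel_D1Rep hLc hL2 hN (lockΛ_pin hLc) (-((Lc : ℝ) ^ 12 / 4)) γ hγ hM hInv hclsW₀ hRW₀p hBord0 hBord0'' hM₂0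
    a ha h12 h126 hSL k hμν hNc Jc htel hc hMw hML hrep

/-! ## §7 (v1.1) The read-out-level reading: the letters serve exactly `D1Tel ⟹ D1Sum`; `D1Drift ⟸ D1Sum ∧ D1Rep` with NO letter -/

/-- [folklore] **THE FIVE LETTERS ∧ `D1Tel` ⟹ `D1Sum` FOR `JsRowD1`** (every channel `(μ, ν)`): the lead's `StepDriftWitness.d1Sum_of_d1Tel` at
`Js := JsRowD1 …` with hW∕hR from §4 — the ONLY place the letters enter the row.  CONDITIONAL. -/
theorem d1Sum_JsRowD1_of_letters_D1Tel (hLc : Odd Lc) {N : ℕ} (hN : 2 ≤ N) {cΛ : ℝ} (hΛ : cΛ * (Lc : ℝ) ^ 4 = 2) (cB : ℝ)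
    (γ : ℕ → ℝ) (hγ : ∀ j, γ j = -((Lc : ℝ) ^ 8 / 2) * wVH 3 Lc j / (stepScale 3 Lc j * (Lc : ℝ) ^ 4))
    (hM : ∀ (α κ : Fin 4) (u : Fin 4 → ℤ) (ρ' : Fin 4) (w : Fin 4 → ℤ),
      mixFFAt (toSite (ctrOff 4 Lc)) Lc κ (bref α κ u) ρ' (bref α ρ' w) =
        (reflSign α κ * reflSign α ρ') • refK (Φ Lc α)
          (mixFFAt (toSite (ctrOff 4 Lc)) Lc κ u ρ' w
            + (2 : ℝ) • comp (diagK (ctGen 3 α Lc κ u)) (hessFFAt (toSite (ctrOff 4 Lc)) Lc ρ' w)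
            + (2 * (if ρ' = α then linKerAt (toSite (ctrOff 4 Lc)) Lc ρ' w (κ, u) else 0)) • hessFFAt (toSite (ctrOff 4 Lc)) Lc ρ' w))
    (hInv : ∀ (α κ : Fin 4) (u : Fin 4 → ℤ) (κ' : Fin 4) (u' x z : Fin 4 → ℤ) (β m : Fin 4),
      (actB Lc α (cB • vh₂SAn1 Lc - Twall Lc cΛ γ) - (cB • vh₂SAn1 Lc - Twall Lc cΛ γ)) κ u κ' u' x z (Sum.inl β) (Sum.inr m) = 0)
    {RW₀ : (Fin (3 + 1) → ℤ) → Fin (3 + 1) → (Fin (3 + 1) → ℤ) → MKer (3 + 1) (Fib 3)}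
    (hclsW₀ : ∃ C δ : ℝ, 0 < δ ∧ ∀ y, VertexFamily (RW₀ y) Lc C δ)
    (hRW₀p : ∀ y ρ' w, trK (RW₀ y ρ' w) = -sgnK (RW₀ y ρ' w))
    (hBord0 : ∀ (Y : Fin (3 + 1) → ℤ) (κ' : Fin (3 + 1)) (u' : Fin (3 + 1) → ℤ),
      (stepScale 3 Lc 0 * (Lc : ℝ) ^ (3 + 1))⁻¹ • ∑ v ∈ box (3 + 1) Lc, divV (fun κ u => cB • vh₂SAn1 Lc κ u κ' u') ((Lc : ℤ) • Y + toSite v) =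
        comp ((-((Lc : ℝ) ^ (3 + 1) * (1 / 2) * (Lc : ℝ) ^ (3 + 1))) • vhSAt (toSite (ctrOff 4 Lc)) 3 Lc rfl κ' u') (diagK (((1 : ℝ) / 2) • ∑ v ∈ box (3 + 1) Lc, legInd (toSite (ctrOff 4 Lc)) ((Lc : ℤ) • Y + toSite v)))
          - comp (diagK (((1 : ℝ) / 2) • ∑ v ∈ box (3 + 1) Lc, legInd (toSite (ctrOff 4 Lc)) ((Lc : ℤ) • Y + toSite v))) ((-((Lc : ℝ) ^ (3 + 1) * (1 / 2) * (Lc : ℝ) ^ (3 + 1))) • vhSAt (toSite (ctrOff 4 Lc)) 3 Lc rfl κ' u'))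
    (hBord0'' : ∀ (Y : Fin (3 + 1) → ℤ) (κ : Fin (3 + 1)) (u : Fin (3 + 1) → ℤ),
      (stepScale 3 Lc 0 * (Lc : ℝ) ^ (3 + 1))⁻¹ • ∑ v ∈ box (3 + 1) Lc, divV (fun κ' u' => cB • vh₂SAn1 Lc κ u κ' u') ((Lc : ℤ) • Y + toSite v) =
        comp ((-((Lc : ℝ) ^ (3 + 1) * (1 / 2) * (Lc : ℝ) ^ (3 + 1))) • vhSAt (toSite (ctrOff 4 Lc)) 3 Lc rfl κ u) (diagK (((1 : ℝ) / 2) • ∑ v ∈ box (3 + 1) Lc, legInd (toSite (ctrOff 4 Lc)) ((Lc : ℤ) • Y + toSite v)))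
          - comp (diagK (((1 : ℝ) / 2) • ∑ v ∈ box (3 + 1) Lc, legInd (toSite (ctrOff 4 Lc)) ((Lc : ℤ) • Y + toSite v))) ((-((Lc : ℝ) ^ (3 + 1) * (1 / 2) * (Lc : ℝ) ^ (3 + 1))) • vhSAt (toSite (ctrOff 4 Lc)) 3 Lc rfl κ u))
    (hM₂0 : ∀ (y : Fin (3 + 1) → ℤ) (ρ' : Fin (3 + 1)) (w : Fin (3 + 1) → ℤ),
      (stepScale 3 Lc 0 * (Lc : ℝ) ^ (3 + 1))⁻¹ • ∑ v ∈ box (3 + 1) Lc, divV (fun κ u => M2Of 3 Lc (mixFFAt (toSite (ctrOff 4 Lc)) Lc) 0 κ u ρ' w) ((Lc : ℤ) • y + toSite v) =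
        comp (M1At 3 Lc (toSite (ctrOff 4 Lc)) cΛ 0 ρ' w) (diagK (((1 : ℝ) / 2) • ∑ v ∈ box (3 + 1) Lc, legInd (toSite (ctrOff 4 Lc)) ((Lc : ℤ) • y + toSite v)))
          - comp (diagK (((1 : ℝ) / 2) • ∑ v ∈ box (3 + 1) Lc, legInd (toSite (ctrOff 4 Lc)) ((Lc : ℤ) • y + toSite v))) (M1At 3 Lc (toSite (ctrOff 4 Lc)) cΛ 0 ρ' w)
          + RW₀ y ρ' w)
    (Jc : ∀ m : ℕ, JetData 3 (Lc ^ m)) (htel : D1Tel Lc (JsRowD1 hLc N cΛ cB) Jc) (μ ν : Fin 4) :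
    D1Sum Lc (JsRowD1 hLc N cΛ cB) Jc μ ν := by
  obtain ⟨hW, hR⟩ := symmetries_JsRowD1_of_letters hLc hN hΛ cB γ hγ hM hInv hclsW₀ hRW₀p hBord0 hBord0'' hM₂0
  exact d1Sum_of_d1Tel (JsRowD1 hLc N cΛ cB) Jc hW hR htel μ ν

/-- [folklore] **`D1Drift` FOR `JsRowD1` ⟸ `D1Sum` ∧ `D1Rep` — NO LETTER, NO `D1Tel`** (+ printed B5 facts, window, `μ ≠ ν`, `Nc ≠ 0`, `2 ≤ Lc`):
the lead's `StepDriftWitness.d1Drift_of_d1Sum_D1Rep` at `Js := JsRowD1 …`.  CONDITIONAL. -/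
theorem d1Drift_JsRowD1_of_d1Sum_D1Rep (hLc : Odd Lc) (hL2 : 2 ≤ Lc) (N : ℕ) (cΛ cB : ℝ)
    (a : ℝ) (ha : 0 < a)
    (h12 : B5.Prop12Printed (fam (fun i : ℕ+ × ℕ => ((i.1 : ℕ+) : ℕ)) (fun i => i.1.pos) MvE a ha))
    (h126 : B5.Kernel126_127Printed (kfam (fun i : ℕ+ × ℕ => ((i.1 : ℕ+) : ℕ)) MvE))
    {L : Type*} {SL : Finset L} (hSL : SL.Nonempty) (k : L → Fin 4) {μ ν : Fin 4} (hμν : μ ≠ ν) {Nc : ℝ} (hNc : Nc ≠ 0)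
    (Jc : ∀ m : ℕ, JetData 3 (Lc ^ m)) (hsum : D1Sum Lc (JsRowD1 hLc N cΛ cB) Jc μ ν)
    {cc : ℝ} {M : ℕ → ℕ} (hc : 1 ≤ cc) (hMw : ∀ L : ℕ, 2 ≤ L → 1 ≤ M L ∧ (L : ℝ) ≤ cc * M L) (hML : ∀ L : ℕ, 2 ≤ L → M L ≤ L)
    (hrep : D1Rep Lc Jc Nc μ ν a SL k) :
    D1Drift Lc (JsRowD1 hLc N cΛ cB) Nc μ ν :=
  d1Drift_of_d1Sum_D1Rep a ha h12 h126 hSL k hμν hNc hL2 (JsRowD1 hLc N cΛ cB) Jc hsum hc hMw hML hrep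

end

end Summit.QuantumFields.BalabanUV.Beta.RowD1JointEnd
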